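import Summits.BirchSwinnertonDyer.BirchSwinnertonDyer.Theorems.ByReductionTypeAtTwoGoodOrdTowerControlCocycle
import HarnessLib

/-!
# Route `ByReductionTypeAtTwo`, item `OrdKatoHalfAtTwo` (stmt-BirchSwinnertonDyer-19271), TOWER road, the
# GOOD-ORDINARY local tower kernels at `v ∣ 2` at FULL `2`-power depth: BRICK B, part 2 — the Kummer count on `E₁` at
# depth `p^k`, with GENUINE cocycle coefficients `Ê[p^k]` (part 1 = `…GoodOrdTowerControlCocycle.lean`)

HONEST FRAMING (cell `bsd-2adic`, run/shared/lean/pub/bsd-2adic/, seat `bsd-2adic-tower-1` GEN 20, HUMAN RULINGS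
D-0036 / D-0054 / D-0074): TOOL theorems only (no definition, no named fact, no `sorry`); closes nothing by itself;
nothing booked; BSD is not proved by any of this. Brick B of the programme «UNIFORM layer bound
`∃ C, ∀ n, #𝒦_{v,n}[2^∞] ≤ C` at a good ordinary `2` over `ℚ`» ⇒ `WeierstrassCurve.Greenberg1999_kerG_bounded` at `p = 2`
⇒ Mazur's control theorem `WeierstrassCurve.selmer_control` over `ℚ` at `p = 2` (Greenberg, LNM 1716, Thm. 1.2). It is
the depth-`p^k` form of GEN 11's BRICKS G2/G3 (`…GoodOrdTowerCoinvCocycle.lean`, `…GoodOrdTowerCoinvKummer.lean`), whose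
depth-`p` form used that `Ê[p]` is fixed by `Γ` (automatic at `p = 2`); at depth `p^k`, `k ≥ 2`, the torsion `Ê[p^k]` is
NOT Galois-trivial, so the crossed homomorphisms become genuine continuous `1`-cocycles of the discrete `H_n`-module
`Z ≅ Ê[p^k]` and the count is against `#H¹(H_n, Z)` (Mathlib's continuous cohomology of `discreteTopRep H_n Z`).
Setting (as in G2/G3): `p` any prime, `κ` cyclotomic, `v ∋ p`, `K = ℚ_v`, `Γ = Gal(K̄/K)`, `H_n`, `H_∞`, `E(K̄_v) = localPoints W K`,
`g ∈ H_n` a topological generator modulo `H_∞`, `A₁ ≤ E(K̄_v)` a `Γ`-stable subgroup (`E₁(K̄_v) = Ê(𝔪̄)`).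

* `exists_contOneCocycles_inflate_pow` — G2 at depth `p^k`: for `x ∈ A₁`, `y` fixed by `H_∞` with `p^k x = g y − y`, if the
  `p^k`-torsion of `A₁` is fixed pointwise by some layer group `H_{m₀}` (finite level — `Ê[p^k]` is finite), there is a
  continuous `1`-cocycle `c` of `H_n` with values in `A₁`, vanishing on `H_∞`, `c(g) = x`, `p^k c(σ) = σ y − y`.
* `natCard_torsionBy_coinv_mul_card_quotient_le_card_H1` — G3 at depth `p^k`: with `M₁ = A₁ ∩ E(K̄_v)^{H_∞}`, `D₁ = g − 1`,
  `Aₙ = A₁ ∩ E(K̄_v)^{H_n}`, `A₁` `p^k`-divisible, and `Z` a discrete `Γ`-module mapped by an injective EQUIVARIANT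
  `ιZ : Z → E(K̄_v)` onto `A₁[p^k]`: if `H¹(H_n, Z)` is finite then `#(M₁/D₁M₁)[p^k] · #(Aₙ/p^k Aₙ) ≤ #H¹(H_n, Z)` (with
  finiteness). Proof as G3 but in `H¹`: the Kummer map `Aₙ → H¹(H_n, Z)`, `b ↦ [∂b̃]` (`p^k b̃ = b`; the class does not
  depend on the root), has kernel `p^k Aₙ`; `[x] ↦ [c − ∂ỹ] mod κ(Aₙ)` is injective (`χ − χ' = κ(b) + ∂t` forces
  `a = ỹ' − ỹ − b̃ − t ∈ M₁` on `H_∞` and `x − x' = (g − 1)(−a)` at `g`).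

References: R. Greenberg, LNM 1716 (1999), §3 Lemma 3.1 (p. 86), Lemma 3.4 (p. 89) with Prop. 2.5 (p. 80); J.-P. Serre,
*Local Fields*, XIII §1 Prop. 1; J. Silverman, *AEC* VIII §2 (Kummer pairing).
-/

set_option autoImplicit false
-- the Theorems namespace of this sub repeats the summit name by design (D-0017 nested layout: Summit.<S>.<Sub>)
set_option linter.dupNamespace false

noncomputable section

open scoped Classical

universe u

namespace Summit.BirchSwinnertonDyer.BirchSwinnertonDyer.Theorems.GoodOrdTower

open NumberField IsDedekindDomain Field PadicInt Literature.NumberTheory.EllipticCurves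
  Literature.NumberTheory.GaloisRepresentations WeierstrassCurve

variable {p : ℕ} [Fact p.Prime] {κ : ZpExtension ℚ p}

/-! ### The Kummer count at depth `p^k`: `#(A₁^{H_∞}/(g−1))[p^k] · #(A₁^{H_n}/p^k) ≤ #H¹(H_n, A₁[p^k])` -/

set_option maxHeartbeats 800000 in
/-- **Coinvariant `p^k`-torsion classes of the fixed module versus `H¹(H_n, Ê[p^k])` (Kummer on `E₁` at depth `p^k`).**
Setting of `exists_contOneCocycles_inflate_pow`; moreover `A₁` is `p^k`-DIVISIBLE (hypothesis (div₁) of Greenberg's Lemma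
3.4, iterated) and its `p^k`-torsion `A₁[p^k]` is the image of an injective additive `ιZ : Z → E(K̄_v)` EQUIVARIANT for a
discrete `Γ`-module structure on `Z` (so `Z ≅ Ê[p^k]` as a Galois module — NOT trivial for `k ≥ 2`). Let
`M₁ = A₁ ∩ E(K̄_v)^{H_∞}` with `D₁ = g − 1` on it, and `Aₙ = A₁ ∩ E(K̄_v)^{H_n}`. If `H¹(H_n, Z)` (continuous cohomology of
the discrete `H_n`-module `Z`) is finite, then the `p^k`-torsion of `M₁/D₁M₁` and the quotient `Aₙ/p^k Aₙ` are finite and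
`#(M₁/D₁ M₁)[p^k] · #(Aₙ/p^k Aₙ) ≤ #H¹(H_n, Z)`.
Proof: the Kummer map `κ : Aₙ → H¹(H_n, Z)`, `b ↦ [σ ↦ σ b̃ − b̃]` (`p^k b̃ = b`; the CLASS is independent of the root,
two roots differing by an element of `A₁[p^k] = ιZ(Z)` whose coboundary is a coboundary of `Z`) is additive with kernel
`p^k Aₙ` (`[∂b̃] = 0` gives `z` with `b̃ − ιZ z ∈ Aₙ`, so `b = p^k (b̃ − ιZ z)`); to a class `[x]` with `p^k x = D₁ y` attach
`χ = [c − ∂ỹ]` (`c` the inflated cocycle, `p^k ỹ = y`); `[x] ↦ χ mod κ(Aₙ)` is injective: `χ − χ' − κ(b) = [∂z]` forces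
`a = ỹ' − ỹ − b̃ − ιZ z ∈ M₁` (evaluate on `H_∞`) and `x − x' = −(g a − a)` (evaluate at `g`). This is the Kummer sequence
`A₁^{H_n}/p^k ↪ H¹(H_n, A₁[p^k]) ↠ H¹(H_n, A₁)[p^k]` combined with `(A₁^{H_∞}/(g−1))[p^k] ↪ H¹(H_n, A₁)[p^k]`, in cocycles.
[cite: GreenbergLNM1716, §3 Lemma 3.4 (p. 89) with Prop. 2.5 (p. 80)] [cite: SerreLocalFields1979, XIII §1 Prop. 1] -/
theorem natCard_torsionBy_coinv_mul_card_quotient_le_card_H1 (hκ : κ.IsCyclotomic)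
    (v : HeightOneSpectrum (𝓞 ℚ)) (hv : ((p : ℕ) : 𝓞 ℚ) ∈ v.asIdeal) (W : WeierstrassCurve ℚ) (n k m₀ : ℕ)
    {g : absoluteGaloisGroup (v.adicCompletion ℚ)}
    (hg : g ∈ localSubgroup (κ.layerSubgroup n) (v.adicCompletion ℚ))
    (hgen : ∀ U : Subgroup (absoluteGaloisGroup (v.adicCompletion ℚ)),
      IsOpen (U : Set (absoluteGaloisGroup (v.adicCompletion ℚ))) →
        localSubgroup κ.kerSubgroup (v.adicCompletion ℚ) ≤ U → g ∈ U →
          localSubgroup (κ.layerSubgroup n) (v.adicCompletion ℚ) ≤ U)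
    (A₁ : AddSubgroup (localPoints W (v.adicCompletion ℚ)))
    (hstab : ∀ (σ : absoluteGaloisGroup (v.adicCompletion ℚ)) (a : localPoints W (v.adicCompletion ℚ)),
      a ∈ A₁ → σ • a ∈ A₁)
    (hdivk : ∀ a ∈ A₁, ∃ b ∈ A₁, p ^ k • b = a)
    (hZ : ∀ a ∈ A₁, p ^ k • a = 0 → ∀ h ∈ localSubgroup (κ.layerSubgroup m₀) (v.adicCompletion ℚ), h • a = a)
    {Z : Type} [AddCommGroup Z] [DistribMulAction (absoluteGaloisGroup (v.adicCompletion ℚ)) Z]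
    [TopologicalSpace Z] [DiscreteTopology Z]
    (ιZ : Z →+ localPoints W (v.adicCompletion ℚ)) (hιZ : Function.Injective ιZ)
    (hZr : ∀ a : localPoints W (v.adicCompletion ℚ), a ∈ A₁ ∧ p ^ k • a = 0 ↔ a ∈ ιZ.range)
    (hιeq : ∀ (σ : absoluteGaloisGroup (v.adicCompletion ℚ)) (z : Z), ιZ (σ • z) = σ • ιZ z)
    (M₁ : AddSubgroup (localPoints W (v.adicCompletion ℚ)))
    (hM₁ : ∀ a, a ∈ M₁ ↔ a ∈ A₁ ∧ ∀ h ∈ localSubgroup κ.kerSubgroup (v.adicCompletion ℚ), h • a = a)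
    (D₁ : M₁ →+ M₁) (hD₁ : ∀ a : M₁, ((D₁ a : M₁) : localPoints W (v.adicCompletion ℚ)) = g • (a : _) - a)
    (Aₙ : AddSubgroup (localPoints W (v.adicCompletion ℚ)))
    (hAₙ : ∀ a, a ∈ Aₙ ↔ a ∈ A₁ ∧ ∀ σ ∈ localSubgroup (κ.layerSubgroup n) (v.adicCompletion ℚ), σ • a = a)
    [Finite (discreteH1 (localSubgroup (κ.layerSubgroup n) (v.adicCompletion ℚ)) Z)] :
    Finite {c : M₁ ⧸ D₁.range // p ^ k • c = 0} ∧
      Finite (Aₙ ⧸ (nsmulAddMonoidHom (p ^ k) : Aₙ →+ Aₙ).range) ∧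
      Nat.card {c : M₁ ⧸ D₁.range // p ^ k • c = 0} *
          Nat.card (Aₙ ⧸ (nsmulAddMonoidHom (p ^ k) : Aₙ →+ Aₙ).range) ≤
        Nat.card (discreteH1 (localSubgroup (κ.layerSubgroup n) (v.adicCompletion ℚ)) Z) := by
  -- notation
  let K := v.adicCompletion ℚ
  let P : Type := localPoints W K
  let Hn : Subgroup (absoluteGaloisGroup K) := localSubgroup (κ.layerSubgroup n) K
  let γ : Hn := ⟨g, hg⟩
  let X : TopRep ℤ Hn := discreteTopRep Hn Z
  have hXρ : ∀ (σ : Hn) (z : Z), X.ρ σ z = (σ : absoluteGaloisGroup K) • z := fun _ _ ↦ rfl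
  -- a left inverse of `ιZ`
  obtain ⟨linv, hlinv⟩ := hιZ.hasLeftInverse
  have hιlinv : ∀ a : P, a ∈ A₁ → p ^ k • a = 0 → ιZ (linv a) = a := fun a ha hpa ↦ by
    obtain ⟨z, rfl⟩ := (hZr a).mp ⟨ha, hpa⟩
    rw [hlinv z]
  have hιA : ∀ z : Z, ιZ z ∈ A₁ := fun z ↦ ((hZr (ιZ z)).mpr ⟨z, rfl⟩).1
  have hιp : ∀ z : Z, p ^ k • ιZ z = 0 := fun z ↦ ((hZr (ιZ z)).mpr ⟨z, rfl⟩).2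
  -- a continuous `A₁[p^k]`-valued crossed homomorphism of `H_n` gives a continuous `1`-cocycle of `Z`
  have hmk : ∀ w : Hn → P, Continuous w → (∀ σ, w σ ∈ A₁ ∧ p ^ k • w σ = 0) →
      (∀ σ τ, w (σ * τ) = w σ + (σ : absoluteGaloisGroup K) • w τ) →
        ∃ f : contOneCocycles X, ∀ σ, ιZ (f.1 σ) = w σ := by
    intro w hw hwZ hcoc
    have hcont : Continuous (linv ∘ w) := (((IsLocallyConstant.iff_continuous w).mpr hw).comp linv).continuous
    refine ⟨⟨⟨linv ∘ w, hcont⟩, fun σ τ ↦ hιZ ?_⟩, fun σ ↦ hιlinv _ (hwZ σ).1 (hwZ σ).2⟩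
    change ιZ (linv (w (σ * τ))) = ιZ (linv (w σ) + X.ρ σ (linv (w τ)))
    rw [map_add, hXρ, hιeq, hιlinv _ (hwZ _).1 (hwZ _).2, hιlinv _ (hwZ _).1 (hwZ _).2,
      hιlinv _ (hwZ _).1 (hwZ _).2, hcoc]
  -- two cocycles with the same `ιZ`-values are equal
  have hext : ∀ f f' : contOneCocycles X, (∀ σ, ιZ (f.1 σ) = ιZ (f'.1 σ)) → f = f' := fun f f' h ↦
    Subtype.ext (ContinuousMap.ext fun σ ↦ hιZ (h σ))
  -- classes: `[f] = [f']` as soon as `f - f'` is the coboundary of some `z`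
  have hcls : ∀ (f f' : contOneCocycles X) (z : Z),
      (∀ σ : Hn, ιZ (f.1 σ) - ιZ (f'.1 σ) = (σ : absoluteGaloisGroup K) • ιZ z - ιZ z) →
        oneCocycleClass X f = oneCocycleClass X f' := by
    intro f f' z h
    rw [← sub_eq_zero, ← oneCocycleClass_sub, oneCocycleClass_eq_zero_iff]
    refine ⟨z, fun σ ↦ hιZ ?_⟩
    change ιZ (f.1 σ - f'.1 σ) = ιZ (X.ρ σ z - z)
    rw [map_sub, map_sub, hXρ, hιeq, h σ]
  -- coboundaries `σ ↦ σ t - t` of elements `t ∈ A₁` with `p^k t` fixed by `H_n`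
  have hcob : ∀ t : P, t ∈ A₁ → (∀ σ : Hn, (σ : absoluteGaloisGroup K) • (p ^ k • t) = p ^ k • t) →
      ∃ f : contOneCocycles X, ∀ σ : Hn, ιZ (f.1 σ) = (σ : absoluteGaloisGroup K) • t - t := by
    intro t ht hpt
    refine hmk _ (((continuous_smul_localPoints W K t).comp continuous_subtype_val).sub continuous_const)
      (fun σ ↦ ⟨A₁.sub_mem (hstab _ _ ht) ht, ?_⟩) (fun σ τ ↦ ?_)
    · rw [smul_sub, smul_comm, hpt σ, sub_self]
    · rw [Subgroup.coe_mul, mul_smul, smul_sub]; abel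
  -- roots: `rt a ∈ A₁`, `p^k • rt a = a` for `a ∈ A₁`
  choose rt hrtA hrt using hdivk
  -- the root of `b ∈ Aₙ`
  have hAₙA : ∀ b : Aₙ, (b : P) ∈ A₁ := fun b ↦ ((hAₙ b).mp b.2).1
  have hrtfix : ∀ (b : Aₙ) (σ : Hn), (σ : absoluteGaloisGroup K) • (p ^ k • rt b (hAₙA b)) = p ^ k • rt b (hAₙA b) :=
    fun b σ ↦ by rw [hrt b (hAₙA b)]; exact ((hAₙ b).mp b.2).2 _ σ.2
  choose kc hkc using fun b : Aₙ ↦ hcob _ (hrtA b (hAₙA b)) (hrtfix b)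
  -- independence of the root, in `H¹`: `[∂t] = [∂t']` when `p^k t = p^k t'` (two roots differ by an element of `ιZ(Z)`)
  have hindep : ∀ (f f' : contOneCocycles X) (t t' : P), t ∈ A₁ → t' ∈ A₁ → p ^ k • t = p ^ k • t' →
      (∀ σ : Hn, ιZ (f.1 σ) = (σ : absoluteGaloisGroup K) • t - t) →
      (∀ σ : Hn, ιZ (f'.1 σ) = (σ : absoluteGaloisGroup K) • t' - t') →
        oneCocycleClass X f = oneCocycleClass X f' := by
    intro f f' t t' ht ht' hp hf hf'
    obtain ⟨z, hz⟩ := (hZr (t - t')).mp ⟨A₁.sub_mem ht ht', by rw [smul_sub, hp, sub_self]⟩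
    refine hcls f f' z fun σ ↦ ?_
    rw [hf, hf', hz, smul_sub]
    abel
  -- the Kummer map `kum : Aₙ →+ H¹(H_n, Z)`, `b ↦ [σ ↦ σ b̃ - b̃]`
  let kum : Aₙ →+ discreteH1 Hn Z :=
    { toFun := fun b ↦ oneCocycleClass X (kc b)
      map_zero' := by
        rw [← oneCocycleClass_zero X]
        refine hindep _ _ (rt _ (hAₙA 0)) 0 (hrtA _ _) A₁.zero_mem (by rw [hrt, smul_zero]; rfl) (hkc 0)
          fun σ ↦ ?_
        rw [smul_zero, sub_zero]
        exact map_zero ιZ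
      map_add' := fun b b' ↦ by
        rw [← oneCocycleClass_add]
        refine hindep _ _ (rt _ (hAₙA (b + b'))) (rt b (hAₙA b) + rt b' (hAₙA b')) (hrtA _ _)
          (A₁.add_mem (hrtA _ _) (hrtA _ _)) (by rw [hrt, smul_add, hrt, hrt]; rfl) (hkc (b + b')) fun σ ↦ ?_
        change ιZ ((kc b).1 σ + (kc b').1 σ) = _
        rw [map_add, hkc, hkc, smul_add]
        abel }
  have hkum : ∀ b : Aₙ, kum b = oneCocycleClass X (kc b) := fun _ ↦ rfl
  -- `ker kum = p^k Aₙ`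
  have hker : kum.ker = (nsmulAddMonoidHom (p ^ k) : Aₙ →+ Aₙ).range := by
    ext b
    rw [AddMonoidHom.mem_ker, AddMonoidHom.mem_range, hkum]
    constructor
    · intro hb
      obtain ⟨z, hz⟩ := (oneCocycleClass_eq_zero_iff X (kc b)).mp hb
      -- `b̃ - ιZ z` is fixed by `H_n`
      have hfix : ∀ σ : Hn, (σ : absoluteGaloisGroup K) • (rt b (hAₙA b) - ιZ z) = rt b (hAₙA b) - ιZ z := by
        intro σ
        have h := congrArg ιZ (hz σ)
        rw [hkc, hXρ, map_sub, hιeq] at h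
        rw [smul_sub, sub_eq_sub_iff_sub_eq_sub, h]
      refine ⟨⟨rt b (hAₙA b) - ιZ z, (hAₙ _).mpr ⟨A₁.sub_mem (hrtA _ _) (hιA z), fun σ hσ ↦ hfix ⟨σ, hσ⟩⟩⟩,
        Subtype.ext ?_⟩
      change p ^ k • (rt b (hAₙA b) - ιZ z) = b
      rw [smul_sub, hrt, hιp, sub_zero]
    · rintro ⟨a, rfl⟩
      rw [← oneCocycleClass_zero X]
      refine hindep _ _ (rt _ (hAₙA ((nsmulAddMonoidHom (p ^ k) : Aₙ →+ Aₙ) a))) (a : P) (hrtA _ _) (hAₙA a)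
        (by rw [hrt]; rfl) (hkc _) fun σ ↦ ?_
      rw [((hAₙ a).mp a.2).2 _ σ.2, sub_self]
      exact map_zero ιZ
  -- `#(Aₙ/p^kAₙ) = #range kum`
  have hcardK : Nat.card (Aₙ ⧸ (nsmulAddMonoidHom (p ^ k) : Aₙ →+ Aₙ).range) = Nat.card kum.range := by
    rw [← hker]
    exact Nat.card_congr (QuotientAddGroup.quotientKerEquivRange kum).toEquiv
  haveI hKfin : Finite kum.range := inferInstance
  -- `M₁`
  have hM₁A : ∀ x : M₁, (x : P) ∈ A₁ := fun x ↦ ((hM₁ x).mp x.2).1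
  have hM₁i : ∀ x : M₁, ∀ h ∈ localSubgroup κ.kerSubgroup K, h • (x : P) = x := fun x ↦ ((hM₁ x).mp x.2).2
  -- representatives and the relation `p^k x = g y - y`
  have hrep : ∀ c : {c : M₁ ⧸ D₁.range // p ^ k • c = 0}, ∃ x y : M₁,
      (QuotientAddGroup.mk x : M₁ ⧸ D₁.range) = c.1 ∧ p ^ k • (x : P) = g • (y : P) - y := by
    intro c
    obtain ⟨x, hx⟩ := QuotientAddGroup.mk_surjective c.1
    have hpx : (QuotientAddGroup.mk (p ^ k • x) : M₁ ⧸ D₁.range) = 0 := by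
      rw [QuotientAddGroup.mk_nsmul, hx]; exact c.2
    rw [QuotientAddGroup.eq_zero_iff] at hpx
    obtain ⟨y, hy⟩ := hpx
    refine ⟨x, y, hx, ?_⟩
    rw [← hD₁ y, hy, AddSubgroup.coe_nsmul]
  choose xr yr hxr hrel using hrep
  -- the inflated cocycles
  have hcoc : ∀ c : {c : M₁ ⧸ D₁.range // p ^ k • c = 0}, ∃ cc : contOneCocycles (discreteTopRep Hn P),
      (∀ σ : Hn, (σ : absoluteGaloisGroup K) ∈ localSubgroup κ.kerSubgroup K → cc.1 σ = 0) ∧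
      cc.1 γ = (xr c : P) ∧ (∀ σ : Hn, cc.1 σ ∈ A₁) ∧
      (∀ σ : Hn, p ^ k • cc.1 σ = (σ : absoluteGaloisGroup K) • (yr c : P) - yr c) := fun c ↦
    exists_contOneCocycles_inflate_pow hκ v hv W n k m₀ hg hgen A₁ hstab hZ
      (hM₁A (xr c)) (hM₁i (xr c)) (hM₁i (yr c)) (hrel c)
  choose cc hcc0 hccγ hccA hccp using hcoc
  -- `χ_c = cc - ∂ỹ` with `ỹ = rt y`: a continuous `A₁[p^k]`-valued crossed homomorphism of `H_n`
  have hchi : ∀ c : {c : M₁ ⧸ D₁.range // p ^ k • c = 0}, ∃ f : contOneCocycles X, ∀ σ : Hn,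
      ιZ (f.1 σ) = (cc c).1 σ -
        ((σ : absoluteGaloisGroup K) • rt (yr c : P) (hM₁A (yr c)) - rt (yr c : P) (hM₁A (yr c))) := by
    intro c
    refine hmk _ (((cc c).1.continuous).sub
      (((continuous_smul_localPoints W K _).comp continuous_subtype_val).sub continuous_const))
      (fun σ ↦ ⟨A₁.sub_mem (hccA c σ) (A₁.sub_mem (hstab _ _ (hrtA _ _)) (hrtA _ _)), ?_⟩) (fun σ τ ↦ ?_)
    · rw [smul_sub, hccp c σ, smul_sub, smul_comm, hrt, sub_self]
    · have h1 := (cc c).2 σ τ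
      change (cc c).1 (σ * τ) = (cc c).1 σ + (σ : absoluteGaloisGroup K) • (cc c).1 τ at h1
      rw [h1, Subgroup.coe_mul, mul_smul, smul_sub, smul_sub]
      abel
  choose chi hchi_apply using hchi
  -- `Φ c = [χ_c] mod range kum` is injective
  let Φ : {c : M₁ ⧸ D₁.range // p ^ k • c = 0} → discreteH1 Hn Z ⧸ kum.range :=
    fun c ↦ QuotientAddGroup.mk (oneCocycleClass X (chi c))
  have hΦ : Function.Injective Φ := by
    intro c c' hcc'
    have hmem : oneCocycleClass X (chi c) - oneCocycleClass X (chi c') ∈ kum.range := by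
      rw [← QuotientAddGroup.eq_iff_sub_mem]
      exact hcc'
    obtain ⟨b, hb⟩ := hmem
    rw [hkum, ← oneCocycleClass_sub, eq_comm, ← sub_eq_zero, ← oneCocycleClass_sub, oneCocycleClass_eq_zero_iff] at hb
    obtain ⟨z, hz⟩ := hb
    -- the values: `χ_c σ - χ_{c'} σ - (σ b̃ - b̃) = σ t - t`, `t = ιZ z`
    have hval : ∀ σ : Hn, ((cc c).1 σ - ((σ : absoluteGaloisGroup K) • rt (yr c : P) (hM₁A (yr c)) -
        rt (yr c : P) (hM₁A (yr c)))) - ((cc c').1 σ - ((σ : absoluteGaloisGroup K) •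
          rt (yr c' : P) (hM₁A (yr c')) - rt (yr c' : P) (hM₁A (yr c')))) -
          ((σ : absoluteGaloisGroup K) • rt b (hAₙA b) - rt b (hAₙA b)) =
        (σ : absoluteGaloisGroup K) • ιZ z - ιZ z := by
      intro σ
      have h := congrArg ιZ (hz σ)
      change ιZ ((chi c).1 σ - (chi c').1 σ - (kc b).1 σ) = ιZ (X.ρ σ z - z) at h
      rw [map_sub, map_sub, map_sub, hchi_apply, hchi_apply, hkc, hXρ, hιeq] at h
      exact h
    -- on `H_∞`: `a = ỹ' - ỹ - b̃ - t` is fixed, hence `a ∈ M₁`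
    set a : P := rt (yr c' : P) (hM₁A (yr c')) - rt (yr c : P) (hM₁A (yr c)) - rt b (hAₙA b) - ιZ z with ha_def
    have haA : a ∈ A₁ := A₁.sub_mem (A₁.sub_mem (A₁.sub_mem (hrtA _ _) (hrtA _ _)) (hrtA _ _)) (hιA z)
    have hafix : ∀ h ∈ localSubgroup κ.kerSubgroup K, h • a = a := by
      intro h hh
      have hhn : h ∈ Hn := localSubgroup_ker_le_layer κ K n hh
      have e := hval ⟨h, hhn⟩
      rw [hcc0 c ⟨h, hhn⟩ hh, hcc0 c' ⟨h, hhn⟩ hh, zero_sub, zero_sub] at e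
      change -(h • rt (yr c : P) (hM₁A (yr c)) - rt (yr c : P) (hM₁A (yr c))) -
        -(h • rt (yr c' : P) (hM₁A (yr c')) - rt (yr c' : P) (hM₁A (yr c'))) -
          (h • rt b (hAₙA b) - rt b (hAₙA b)) = h • ιZ z - ιZ z at e
      rw [ha_def, smul_sub, smul_sub, smul_sub]
      have e' := sub_eq_zero.mpr e
      rw [← sub_eq_zero, ← e']
      abel
    have haM : a ∈ M₁ := (hM₁ a).mpr ⟨haA, hafix⟩
    -- at `g`: `x - x' = g (-a) - (-a)`
    have eγ := hval γ
    rw [hccγ c, hccγ c'] at eγ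
    change (xr c : P) - (g • rt (yr c : P) (hM₁A (yr c)) - rt (yr c : P) (hM₁A (yr c))) -
      ((xr c' : P) - (g • rt (yr c' : P) (hM₁A (yr c')) - rt (yr c' : P) (hM₁A (yr c')))) -
        (g • rt b (hAₙA b) - rt b (hAₙA b)) = g • ιZ z - ιZ z at eγ
    have hxx : (xr c : P) - xr c' = g • (-a) - (-a) := by
      have e' := sub_eq_zero.mpr eγ
      rw [← sub_eq_zero, ← e', ha_def]
      simp only [smul_sub, smul_neg]
      abel
    have hD : xr c - xr c' = D₁ ⟨-a, M₁.neg_mem haM⟩ := by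
      refine Subtype.ext ?_
      rw [AddSubgroup.coe_sub, hD₁]
      exact hxx
    apply Subtype.ext
    rw [← hxr c, ← hxr c', QuotientAddGroup.eq_iff_sub_mem, hD]
    exact ⟨_, rfl⟩
  -- counting
  haveI : Finite (discreteH1 Hn Z ⧸ kum.range) := inferInstance
  have h1 : Nat.card {c : M₁ ⧸ D₁.range // p ^ k • c = 0} ≤ Nat.card (discreteH1 Hn Z ⧸ kum.range) :=
    Nat.card_le_card_of_injective Φ hΦ
  have h2 : Nat.card (discreteH1 Hn Z) = Nat.card (discreteH1 Hn Z ⧸ kum.range) * Nat.card kum.range :=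
    AddSubgroup.card_eq_card_quotient_mul_card_addSubgroup _
  refine ⟨Finite.of_injective Φ hΦ, ?_, ?_⟩
  · rw [← hker]
    exact Finite.of_equiv _ (QuotientAddGroup.quotientKerEquivRange kum).toEquiv.symm
  · rw [h2, hcardK]
    exact Nat.mul_le_mul_right _ h1

end Summit.BirchSwinnertonDyer.BirchSwinnertonDyer.Theorems.GoodOrdTower

end
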